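import Literature.MathematicalPhysics.QuantumFieldTheory.Balaban1983to89.B1TorusRegionHSizes
import Literature.MathematicalPhysics.QuantumFieldTheory.Balaban1983to89.B1TorusRegionCubes
import Literature.MathematicalPhysics.QuantumFieldTheory.Balaban1983to89.B1Cor23RegularRegion

/-!
# `Balaban1983to89.B1Lemma21RegularRegion` — [Balaban1983RegularityDecay] LEMMA 2.1 (2.15) p. 577 AND THE `‖·‖_{2,2}` LETTER OF
# (2.21) p. 578 (the factor `‖K_{ω_i}G_k(□_{ω_i}, Ã_{ω_i})h_{ω_i}‖_{2,2} ≤ c₂O(1)M⁻¹` read off from (2.20)–(2.21)) AT THE BOUNDARY PIECES `Ω ∩ □_j`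
# OF A BIG-BLOCK REGION
# `Ω ⊂ T_ε`, FOR THE (Higgs)₂,₃ CARRIER of [Balaban1982Higgs1] (2.20) (`HiggsCovariance.covOpK/propagatorK`, composite contours)
# AT A (2.23)-REGULAR `A` — from r14's coercivity (1.8) for regions, with the sizes and the flat normal of `h_j` of
# `B1TorusRegionHSizes`

statement-level skeleton of published theorems with citation tags; proofs where landed; nothing here is a claim about the Yang–Mills mass gap

PDF held: `paper:balaban1983-cmp89-regularity-decay` pp. 573, 575–580 [PDF 3, 5–10] (text layer and the ×2 renders re-read);
`paper:balaban1982-cmp85-higgs23-i` p. 610 [PDF 8].  Quotation docfix S-B1-g44-1 of ref-4 gen 44 (filed gen 13): the WHAT IS PRINTED block and the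
guillemets below quote only printed sentences, and the ROUTE sentence says where this file departs from the printed proof; no declaration changed.

CITATION HEADER (lean-in-tree rule).  T. Bałaban, *Regularity and decay of lattice Green's functions*, Commun. Math. Phys. **89**
(1983) 571–597 [Balaban1983RegularityDecay] (Lemma 2.1 p. 577, (2.10) p. 576, (2.21) p. 578) and T. Bałaban, *(Higgs)₂,₃ quantum fields
in a finite volume. I*, Commun. Math. Phys. **85** (1982) 603–626 [Balaban1982Higgs1] ((2.20) p. 610, Prop. 2.1 p. 610).  Cell
`lit-balaban` (HOME `run/shared/lean/pub/lit-balaban/`), Phase-2 proof seat **p35** gen 12 (unit `lit-balaban-p35`); SKELETON rows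
**B4.Lem2.1** (model instance: the pieces `Ω ∩ □_j` of the (Higgs)₂,₃ torus at a regular `A`), **B4.Eq2.10**, **B4.Eq2.18**/(2.21) (the
`‖·‖_{2,2}` letters at boundary pieces), feeding **B1.Prop2.1** for regions on the concrete carrier.  USED BY NAME, never restated: r14's
`B1Ineq18RegularRegion.coercive_covOpK_of_reg223` ((1.8) at a regular `A` for block unions, `γ₀ = min{2, a(1 − L⁻²)/4}`), r14's
`B1Cor23RegularRegion.propagatorK_supported`, the typer's `HiggsCovariance`/`HiggsCovariancePos` (`siteInner_covLaplacianN`,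
`covOpK_propagatorK_apply`, `siteInner_projPk_nonneg`), this seat's `B1TorusRegionCubes` (`piece`, `fld`, `Hloc`, `Gloc`, `bOp`,
`piece_blockSat`), `B1TorusRegionHSizes` (`IsBigBlockUnion`, `nlapH`, `abs_nlapH_piece_le`, `abs_hTor_sub_le_of_blockIter_eq`,
`blockSat_of_isBigBlockUnion`), gen 9's `B1TorusCubeDeriv.abs_hTor_shift_sub_le`, p23's `B1Eq353SupNorm.card_blockK`.

WHAT IS PRINTED.  p. 577: *«Lemma 2.1. Let a set □ be an arbitrary sum of unit blocks, but such that it is a sum of at most few large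
blocks, and let A be as in the theorem. Then for e sufficiently small we have ‖G_k(□, A)f‖₂, ‖D^η_{A,μ}G_k(□, A)f‖₂, ‖G_k(□, A)D^{η*}_{A,μ}f‖₂,
‖D^η_{A,μ}G_k(□, A)D^{η*}_{A,ν}f‖₂ ≤ c₂‖f‖₂. (2.15)  Let us notice that Lemma 2.1 implies that the L²-norm of the operator R given by (2.11) is
small for M large enough, so the series in the representation (2.12) is convergent in this norm.»*; p. 576 (2.10) (the definition of
`(K_jφ)(x)`); p. 577: *«In the sequel we will see that R is a small operator in reasonable norms because |∂^ηh_j| ≤ O(M⁻¹), |Δ^ηh_j| ≤ O(M⁻²)»*;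
p. 578, (2.21): *«… Π_{i=n₀+1}^{n} ‖K_{ω_i}G_k(□_{ω_i}, Ã_{ω_i})h_{ω_i}‖_{2,2}‖f‖₂ ≤ Σ′ c₁(c₂O(1)M⁻¹)ⁿ‖f‖_∞»*; p. 573: *«More exactly we prove
that there exists a positive constant γ₀ such that for e sufficiently small and for a regular vector field A −Δ^η_{A,Ω} + aP_k(A) ≥ γ₀I. (1.8)
The constant γ₀ is independent of the lattice spacing η, as well as of Ω and of A.»*; pp. 579–580: *«Proof of Lemma 2.1. The first part of the
proof is the same for Lemma 2.2 and is based on the ideas of the proof of Lemma 2.4 in [2]. We can write the configuration A as a sum A₀ + A′ …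
From these representations and (2.25) we get easily the inequalities (2.15). Thus we have to prove the bounds (2.25). … Now these bounds are
consequences of quadratic form considerations.»*
ROUTE (departure from the printed proof, disclosed).  The print proves (2.15) by the expansion (2.24)–(2.26) of `G_k(□, A)` around a constant
configuration `A₀` and quadratic-form bounds at `A₀`; this file takes the shorter road available in the tree: r14's coercivity (1.8) for block
unions at a (2.23)-regular `A` gives `H_K(S, A) ≥ γ₀(L^Kε)^{−2}` on `S`-supported fields, whence the value and Dirichlet members of (2.15) with
`c₂ = γ₀⁻¹` directly (§2); the two `D^{η*}` members of (2.15) are not needed by the letters of (2.21) used downstream and are not proved here.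

WHAT THIS FILE PROVES (kernel-checked, zero `sorry`, theorems only; no `def`, no `Prop` fact).
* §1 `sNorm_le_of_norm_le`, `sNorm_le_sqrt` — pointwise-to-`L²` comparisons for the scalar product (1.5).
* §2 **LEMMA 2.1 FROM A COERCIVITY CONSTANT** `lemma21_of_coercive`: for `S ⊂ T_ε` a union of `K`-blocks, `m² > 0`, `a_K ≥ 0`, any `A′`
  with `γ(L^Kε)^{−2}‖w‖² ≤ ⟨w, H_K(S,A′)w⟩` on `S`-supported `w`, and `ψ` supported in `S`: `‖G_K(S,A′)ψ‖₂ ≤ γ⁻¹(L^Kε)²‖ψ‖₂` and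
  `⟨Gψ, −Δ^N_{A′,S}Gψ⟩ ≤ γ⁻¹(L^Kε)²‖ψ‖₂²` (the value and Dirichlet members of (2.15) from a coercivity constant as in (1.8) — see ROUTE;
  lattice units of `T_ε`).
* §3 **THE COMMUTATOR (2.10) FOR THE CARRIER**, pointwise: `fwdTerm_comm`, `bwdTerm_comm`, **`covLaplacianN_comm_apply`**
  (`[−Δ^N_S, h]v = ε⁻²((Δ^N_Sh)·v − Σ_μ(∂_μh·fwd_μv + ∂_{−μ}h·bwd_μv))`, `Δ^N_S` the Neumann Laplacian of `B1TorusRegionHSizes.nlapH`),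
  `projPk_comm_apply` / `norm_projPk_comm_apply_le` (`[P_K(A′), h]v` is a transported block average of `(h(x′) − h(x))v(x′)`),
  `covOpK_comm_eq` (the mass term drops); in `L²`: `norm_fwdTerm_eq`, `norm_bwdTerm_eq`, **`sum_sq_fwdTerm_eq` / `sum_sq_bwdTerm_eq`**
  (the Neumann differences square-sum to `ε²⟨v, −Δ^N_Sv⟩`), `sNorm_gradComm_le` (Cauchy–Schwarz over the `2d` bond terms),
  `sNorm_lapComm_le`, **`sNorm_projPk_comm_le`** (block Jensen, `|B^K(y)| = L^{Kd}`: `‖[P_K, h]v‖₂ ≤ σ₃‖v‖₂`), `sNorm_comm_le`, and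
  **`sNorm_comm_propagatorK_le`**: `‖[H_K(S,A′), h]G_K(S,A′)ψ‖₂ ≤ (σ₂γ⁻¹L^{2K} + 2σ₁(dγ⁻¹)^{1/2}L^K + a_Kσ₃γ⁻¹)‖ψ‖₂` for a multiplier
  `h` with `|h(x) − h(x+εe_μ)| ≤ σ₁`, `|(Δ^N_Sh)(x)| ≤ σ₂`, `|h(x) − h(x′)| ≤ σ₃` inside `K`-blocks (lattice units).
* §4 **AT THE BOUNDARY PIECES OF A BIG-BLOCK REGION AT A (2.23)-REGULAR `A`** — `coercive_piece` (r14's (1.8) on `Ω ∩ □_j`),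
  **`lemma21_piece`** ((2.15) for `G_K(Ω ∩ □_j, A)`, `γ₀ = min{2, a(1 − L⁻²)/4}`), `hTor_smul_supported_piece`, `sNorm_hTor_smul_le`, and
  **`sNorm_bOp_le_of_bad`**: for `Ω` a big-block union, `□_j ⊄ Ω`, `A` (2.23)-regular on `Ω` with `d²·c·e_K^β ≤ 1/3`, `1 ≤ K ≤ K_P`,
  `K₀ ≥ 8`, `K₀ ∣ M_P`, `3M ≤ |T_ε|_μ`, `m² > 0`, `a > 0`, `L ≥ 2`, and `φ` supported in `Ω`:
  `‖b_jφ‖₂ = ‖K_jG_K(Ω ∩ □_j, A)(h_jφ)‖₂ ≤ s·(γ₀⁻¹ + 2(dγ₀⁻¹)^{1/2} + aγ₀⁻¹)·K₀⁻¹·‖φ‖₂`, `s = d(D₁+D₂)` — the factor `c₂O(1)M⁻¹` of (2.21),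
  from `lemma21_piece`, the sizes of `h_j` and the flat normal of `B1TorusRegionHSizes`, and `a_K ≤ a`.
HONEST SCOPE.  (i) `L²` = the scalar product (1.5) of `T_ε` (weight `ε^d`), bounds in lattice units; (ii) boundary pieces only (`□_j ⊄ Ω`,
local field `A_j = A`); the interior cubes' graded letters (Lemma 2.2 at `Ã_j`) are the sequel file; (iii) `Ω` a big-block union
(`IsBigBlockUnion`) as printed (p. 575 «thus Ω is a sum of the corresponding large blocks of the size M on η-lattice T_η»); regularity of `A`
asked at the sites of `Ω` in r14's (2.23) currency; (iv)
constants explicit and crude, `m² > 0` used only for the invertibility of (2.20); (v) nothing of (2.12)–(2.13), (2.18)–(2.22) is summed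
here.  Unit `lit-balaban-p35` gen 12 (literature-prover-lit-balaban-p35-g12-0).
-/

open scoped BigOperators InnerProductSpace

noncomputable section

namespace Literature.MathematicalPhysics.QuantumFieldTheory.Balaban1983to89.B1Lemma21RegularRegion

open Literature.MathematicalPhysics.QuantumFieldTheory.Balaban1983to89.HiggsLattice
open Literature.MathematicalPhysics.QuantumFieldTheory.Balaban1983to89.HiggsAveraging
open Literature.MathematicalPhysics.QuantumFieldTheory.Balaban1983to89.HiggsCovariance
open Literature.MathematicalPhysics.QuantumFieldTheory.Balaban1983to89.HiggsCovariancePos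
open Literature.MathematicalPhysics.QuantumFieldTheory.Balaban1983to89.HiggsCovarianceCont (sNorm sNorm_nonneg sNorm_sq
  sNorm_add_le sNorm_smul)
open Literature.MathematicalPhysics.QuantumFieldTheory.Balaban1983to89.HiggsFluctMeasurePos (siteInner_comm siteInner_add_right
  siteInner_smul_right siteInner_sub_right siteInner_le_sNorm_mul)
open Literature.MathematicalPhysics.QuantumFieldTheory.Balaban1983to89.B2Ineq329ZeroAveraging (mesh_eq)
open Literature.MathematicalPhysics.QuantumFieldTheory.Balaban1983to89.B2Restr216Lattice (norm_U_apply)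
open Literature.MathematicalPhysics.QuantumFieldTheory.Balaban1983to89.B2Ineq329CovariantAveraging (U_apply_U)
open Literature.MathematicalPhysics.QuantumFieldTheory.Balaban1983to89.B1Eq353SupNorm (card_blockK)
open Literature.MathematicalPhysics.QuantumFieldTheory.Balaban1983to89.B1Cor23RegularRegion (propagatorK_supported)
open Literature.MathematicalPhysics.QuantumFieldTheory.Balaban1983to89.B1Ineq18RegularRegion (gammaReg_pos coercive_covOpK_of_reg223)
open Literature.MathematicalPhysics.QuantumFieldTheory.Balaban1983to89.B1TorusCubeCover
open Literature.MathematicalPhysics.QuantumFieldTheory.Balaban1983to89.B1TorusCubeLocality26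
open Literature.MathematicalPhysics.QuantumFieldTheory.Balaban1983to89.B1TorusCubeChart (dd M2 predL_succ castD)
open Literature.MathematicalPhysics.QuantumFieldTheory.Balaban1983to89.B1TorusCubeDeriv (abs_hTor_shift_sub_le)
open Literature.MathematicalPhysics.QuantumFieldTheory.Balaban1983to89.B1TorusRegionCubes
open Literature.MathematicalPhysics.QuantumFieldTheory.Balaban1983to89.B1TorusRegionHSizes
open Literature.MathematicalPhysics.QuantumFieldTheory.Balaban1983to89.B4PartitionUnity22 (hprof D1 D2 D1_nonneg D2_nonneg
  contDiff_hprof hasCompactSupport_hprof)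

variable {P : HiggsLattice.Params} {N : ℕ}

/-! ## §1 Pointwise-to-`L²` comparisons -/

section L2

variable {k : ℕ}

/-- `‖f(x)‖ ≤ c‖g(x)‖` pointwise gives `‖f‖₂ ≤ c‖g‖₂` for the scalar product (1.5). [cite: Balaban1982Higgs1, (1.5) p.604] -/
theorem sNorm_le_of_norm_le {f g : ScalarField P k N} {c : ℝ} (hc : 0 ≤ c) (h : ∀ x, ‖f x‖ ≤ c * ‖g x‖) :
    sNorm f ≤ c * sNorm g := by
  have h1 : siteInner f f ≤ c ^ 2 * siteInner g g := by
    rw [siteInner_self_eq, siteInner_self_eq, Finset.mul_sum]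
    refine Finset.sum_le_sum fun x _ => ?_
    have hm : 0 ≤ P.mesh k ^ P.d := pow_nonneg (P.mesh_pos k).le _
    calc P.mesh k ^ P.d * ‖f x‖ ^ 2 ≤ P.mesh k ^ P.d * (c * ‖g x‖) ^ 2 :=
          mul_le_mul_of_nonneg_left (pow_le_pow_left₀ (norm_nonneg _) (h x) 2) hm
      _ = c ^ 2 * (P.mesh k ^ P.d * ‖g x‖ ^ 2) := by ring
  show Real.sqrt (siteInner f f) ≤ c * Real.sqrt (siteInner g g)
  calc Real.sqrt (siteInner f f) ≤ Real.sqrt (c ^ 2 * siteInner g g) := Real.sqrt_le_sqrt h1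
    _ = c * Real.sqrt (siteInner g g) := by rw [Real.sqrt_mul (sq_nonneg c), Real.sqrt_sq hc]

/-- `Σ_x η^d‖f(x)‖² ≤ B` gives `‖f‖₂ ≤ √B`. [cite: Balaban1982Higgs1, (1.5) p.604] -/
theorem sNorm_le_sqrt {f : ScalarField P k N} {B : ℝ} (h : ∑ x : HiggsLattice.Site P k, P.mesh k ^ P.d * ‖f x‖ ^ 2 ≤ B) :
    sNorm f ≤ Real.sqrt B := by
  show Real.sqrt (siteInner f f) ≤ Real.sqrt B
  rw [siteInner_self_eq]
  exact Real.sqrt_le_sqrt h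

/-- `(a + b)² ≤ 2(a² + b²)`. [folklore] -/
private theorem add_sq_le' (a b : ℝ) : (a + b) ^ 2 ≤ 2 * (a ^ 2 + b ^ 2) := by nlinarith [sq_nonneg (a - b)]

end L2

/-! ## §2 Lemma 2.1 from a coercivity constant -/

section Lemma21

variable (C : ChargeData N) {K : ℕ} (S : Finset (HiggsLattice.Site P 0)) (A' : HiggsLattice.VecField P 0) {msq a : ℝ}

/-- **LEMMA 2.1 (2.15) FROM (1.8)** (the value and Dirichlet members of (2.15) from a coercivity constant as in (1.8) p. 573; the print's own
proof runs through the expansion (2.24)–(2.26) pp. 579–580 — a disclosed shorter road): for `S` a union of `K`-blocks of `T_ε`,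
`m² > 0`, `a_K ≥ 0`, any field `A′` with a coercivity constant `γ > 0` on `S`-supported fields, and `ψ` supported in `S`, the solution
`u = G_K(S,A′)ψ` satisfies `‖u‖₂ ≤ γ⁻¹(L^Kε)²‖ψ‖₂` and `⟨u, −Δ^N_{A′,S}u⟩ ≤ γ⁻¹(L^Kε)²‖ψ‖₂²` (value and Dirichlet members of (2.15), in
the lattice units of `T_ε`). [cite: Balaban1983RegularityDecay, Lemma 2.1 (2.15) p.577, proof p.579] -/
theorem lemma21_of_coercive
    (hS : ∀ x x' : HiggsLattice.Site P 0, blockIter K x = blockIter K x' → (x ∈ S ↔ x' ∈ S))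
    (hmsq : 0 < msq) (hak : 0 ≤ B1.aSeq a P.L K) {γ : ℝ} (hγ : 0 < γ)
    (hlow : ∀ w : ScalarField P 0 N, (∀ x, x ∉ S → w x = 0) →
      γ * ((P.mesh K)⁻¹ ^ 2) * siteInner w w ≤ siteInner w (covOpK C S A' msq a K w))
    (ψ : ScalarField P 0 N) (hψ : ∀ x, x ∉ S → ψ x = 0) :
    sNorm (propagatorK C S A' msq a K ψ) ≤ γ⁻¹ * P.mesh K ^ 2 * sNorm ψ ∧
      siteInner (propagatorK C S A' msq a K ψ) (covLaplacianN C S A' (propagatorK C S A' msq a K ψ))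
        ≤ γ⁻¹ * P.mesh K ^ 2 * sNorm ψ ^ 2 := by
  set u := propagatorK C S A' msq a K ψ with hu
  have husupp : ∀ x, x ∉ S → u x = 0 := propagatorK_supported C S A' hmsq hak hS ψ hψ
  have hM : 0 < P.mesh K := P.mesh_pos K
  have hc : 0 < γ * (P.mesh K)⁻¹ ^ 2 := by positivity
  -- `⟨u, Hu⟩ = ⟨u, ψ⟩ ≤ ‖u‖‖ψ‖`
  have hHu : covOpK C S A' msq a K u = ψ := covOpK_propagatorK_apply C S A' hmsq a K hak ψ
  have hform : γ * (P.mesh K)⁻¹ ^ 2 * siteInner u u ≤ sNorm u * sNorm ψ := by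
    have h1 := hlow u husupp
    rw [hHu] at h1
    exact h1.trans (siteInner_le_sNorm_mul u ψ)
  have hu0 : 0 ≤ sNorm u := sNorm_nonneg u
  have hψ0 : 0 ≤ sNorm ψ := sNorm_nonneg ψ
  have huu : siteInner u u = sNorm u ^ 2 := (sNorm_sq u).symm
  -- value member
  have hval : sNorm u ≤ γ⁻¹ * P.mesh K ^ 2 * sNorm ψ := by
    rw [huu] at hform
    by_cases h0 : sNorm u = 0
    · rw [h0]; exact mul_nonneg (mul_nonneg (inv_nonneg.2 hγ.le) (sq_nonneg _)) hψ0
    · have hpos : 0 < sNorm u := lt_of_le_of_ne hu0 (Ne.symm h0)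
      have h2 : sNorm u * (γ * (P.mesh K)⁻¹ ^ 2) ≤ sNorm ψ := by nlinarith
      calc sNorm u = sNorm u * (γ * (P.mesh K)⁻¹ ^ 2) / (γ * (P.mesh K)⁻¹ ^ 2) := by field_simp
        _ ≤ sNorm ψ / (γ * (P.mesh K)⁻¹ ^ 2) := div_le_div_of_nonneg_right h2 hc.le
        _ = γ⁻¹ * P.mesh K ^ 2 * sNorm ψ := by field_simp
  refine ⟨hval, ?_⟩
  -- Dirichlet member: `⟨u, −Δu⟩ ≤ ⟨u, Hu⟩ = ⟨u, ψ⟩ ≤ ‖u‖‖ψ‖ ≤ γ⁻¹m²‖ψ‖²`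
  have hsplit : siteInner u (covOpK C S A' msq a K u)
      = siteInner u (covLaplacianN C S A' u) + msq * siteInner u u
        + B1.aSeq a P.L K * ((P.mesh K)⁻¹ ^ 2) * siteInner u (projPk C A' K u) := by
    rw [covOpK, LinearMap.add_apply, LinearMap.add_apply, LinearMap.smul_apply, LinearMap.smul_apply,
      LinearMap.id_apply, siteInner_add_right, siteInner_add_right, siteInner_smul_right, siteInner_smul_right]
  have hP := siteInner_projPk_nonneg C A' K u
  have hself := siteInner_self_nonneg u
  have hDir : siteInner u (covLaplacianN C S A' u) ≤ siteInner u (covOpK C S A' msq a K u) := by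
    rw [hsplit]
    have h1 : 0 ≤ msq * siteInner u u := mul_nonneg hmsq.le hself
    have h2 : 0 ≤ B1.aSeq a P.L K * ((P.mesh K)⁻¹ ^ 2) * siteInner u (projPk C A' K u) :=
      mul_nonneg (mul_nonneg hak (sq_nonneg _)) hP
    linarith
  rw [hHu] at hDir
  calc siteInner u (covLaplacianN C S A' u) ≤ siteInner u ψ := hDir
    _ ≤ sNorm u * sNorm ψ := siteInner_le_sNorm_mul u ψ
    _ ≤ (γ⁻¹ * P.mesh K ^ 2 * sNorm ψ) * sNorm ψ := mul_le_mul_of_nonneg_right hval hψ0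
    _ = γ⁻¹ * P.mesh K ^ 2 * sNorm ψ ^ 2 := by ring

end Lemma21

/-! ## §3 The commutator (2.10) for the carrier: pointwise identities and `L²` bounds -/

section Commutator

variable (C : ChargeData N) {K : ℕ} (S : Finset (HiggsLattice.Site P 0)) (A' : HiggsLattice.VecField P 0)

/-- `Σ_y Σ_{x ∈ B^K(y)} f(x) = Σ_x f(x)`. [cite: Balaban1982Higgs1, (1.20) p.607] -/
private theorem sum_blockK_sum' {M : Type*} [AddCommMonoid M] (K : ℕ) (f : HiggsLattice.Site P 0 → M) :
    ∑ y : HiggsLattice.Site P K, ∑ x ∈ blockK K y, f x = ∑ x : HiggsLattice.Site P 0, f x := by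
  unfold blockK
  exact Finset.sum_fiberwise_of_maps_to (fun x _ => Finset.mem_univ _) f

/-- The forward Neumann term of the commutator `[−Δ^N_S, h]` at a bond: `(h(x) − h(x+εe_μ))U v(x+εe_μ) =
1_{bond ⊂ S}(h(x) − h(x+εe_μ))v(x) − (h(x) − h(x+εe_μ))·(v(x) − Uv(x+εe_μ))`. [cite: Balaban1983RegularityDecay, (2.10) p.576] -/
theorem fwdTerm_comm (h : HiggsLattice.Site P 0 → ℝ) (v : ScalarField P 0 N) (x : HiggsLattice.Site P 0) (μ : Fin P.d) :
    fwdTerm C S A' x μ (h • v) - h x • fwdTerm C S A' x μ v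
      = (if x ∈ S ∧ x.shift μ ∈ S then (h x - h (x.shift μ)) • v x else 0)
        - (h x - h (x.shift μ)) • fwdTerm C S A' x μ v := by
  rw [fwdTerm_apply, fwdTerm_apply]
  split_ifs with hb
  · simp only [Pi.smul_apply', map_smul, sub_smul, smul_sub]
    abel
  · simp

/-- The backward Neumann term of the commutator, same shape with `x − εe_μ` and `U*`. [cite: Balaban1983RegularityDecay, (2.10) p.576] -/
theorem bwdTerm_comm (h : HiggsLattice.Site P 0 → ℝ) (v : ScalarField P 0 N) (x : HiggsLattice.Site P 0) (μ : Fin P.d) :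
    bwdTerm C S A' x μ (h • v) - h x • bwdTerm C S A' x μ v
      = (if x ∈ S ∧ x.unshift μ ∈ S then (h x - h (x.unshift μ)) • v x else 0)
        - (h x - h (x.unshift μ)) • bwdTerm C S A' x μ v := by
  rw [bwdTerm_apply, bwdTerm_apply]
  split_ifs with hb
  · simp only [Pi.smul_apply', map_smul, sub_smul, smul_sub]
    abel
  · simp

/-- **THE COMMUTATOR `[−Δ^{ε,N}_{A′,S}, h]` AT A SITE** (the first two terms of (2.10) for the carrier's Neumann Laplacian):
`([−Δ^N_S, h]v)(x) = ε⁻²((Δ^N_Sh)(x)·v(x) − Σ_μ((h(x) − h(x+εe_μ))·fwd_μv(x) + (h(x) − h(x−εe_μ))·bwd_μv(x)))`, with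
`(Δ^N_Sh)(x) = Σ_μ(1_{⟨x,x+εe_μ⟩⊂S}(h(x) − h(x+εe_μ)) + 1_{⟨x−εe_μ,x⟩⊂S}(h(x) − h(x−εe_μ)))` the Neumann Laplacian of `h` on `S`
(`B1TorusRegionHSizes.nlapH`) and `fwd_μv(x) = 1(v(x) − Uv(x+εe_μ))`, `bwd_μv(x) = 1(v(x) − U*v(x−εe_μ))` the Neumann differences.
[cite: Balaban1983RegularityDecay, (2.10) p.576] -/
theorem covLaplacianN_comm_apply (h : HiggsLattice.Site P 0 → ℝ) (v : ScalarField P 0 N) (x : HiggsLattice.Site P 0) :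
    (covLaplacianN C S A' (h • v) - h • covLaplacianN C S A' v) x
      = ((P.mesh 0)⁻¹ ^ 2) •
        ((∑ μ : Fin P.d, ((if x ∈ S ∧ x.shift μ ∈ S then h x - h (x.shift μ) else 0)
            + (if x ∈ S ∧ x.unshift μ ∈ S then h x - h (x.unshift μ) else 0))) • v x
          - ∑ μ : Fin P.d, ((h x - h (x.shift μ)) • fwdTerm C S A' x μ v
              + (h x - h (x.unshift μ)) • bwdTerm C S A' x μ v)) := by
  rw [Pi.sub_apply, Pi.smul_apply', covLaplacianN_apply, covLaplacianN_apply, smul_comm (h x) ((P.mesh 0)⁻¹ ^ 2),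
    ← smul_sub]
  congr 1
  rw [Finset.smul_sum, ← Finset.sum_sub_distrib, Finset.sum_smul, ← Finset.sum_sub_distrib]
  refine Finset.sum_congr rfl fun μ _ => ?_
  rw [smul_add, add_sub_add_comm, fwdTerm_comm, bwdTerm_comm, add_smul, ite_smul, zero_smul, ite_smul, zero_smul]
  abel

/-- `‖bwd_μv(x)‖ = ‖fwd_μv(x − εe_μ)‖` (`U` orthogonal, `U*U = 1`). [cite: Balaban1982Higgs1, (2.17) p.610] -/
theorem norm_bwdTerm_eq (v : ScalarField P 0 N) (x : HiggsLattice.Site P 0) (μ : Fin P.d) :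
    ‖bwdTerm C S A' x μ v‖ = ‖fwdTerm C S A' (x.unshift μ) μ v‖ := by
  rw [bwdTerm_apply, fwdTerm_apply, shift_unshift]
  by_cases hc : x ∈ S ∧ x.unshift μ ∈ S
  · rw [if_pos hc, if_pos ⟨hc.2, hc.1⟩, ChargeData.star_U]
    have h1 : v x - C.U (P.mesh 0) (-(A' ⟨x.unshift μ, μ⟩)) (v (x.unshift μ))
        = C.U (P.mesh 0) (-(A' ⟨x.unshift μ, μ⟩)) (C.U (P.mesh 0) (A' ⟨x.unshift μ, μ⟩) (v x) - v (x.unshift μ)) := by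
      rw [map_sub, U_apply_U, neg_add_cancel, ChargeData.U_zero, one_apply_eq_self]
    rw [h1, norm_U_apply, norm_sub_rev]
  · rw [if_neg hc, if_neg (fun h => hc ⟨h.2, h.1⟩)]

/-- `‖fwd v(b)‖ = 1_{b ⊂ S}·ε‖(D^ε_{A′}v)(b)‖`. [cite: Balaban1982Higgs1, (1.7) p.605, (2.17) p.610] -/
theorem norm_fwdTerm_eq (v : ScalarField P 0 N) (b : HiggsLattice.PBond P 0) :
    ‖fwdTerm C S A' b.src b.dir v‖ = if Inside S b then P.mesh 0 * ‖covDeriv C A' v b‖ else 0 := by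
  rw [fwdTerm_apply]
  have hm : 0 < P.mesh 0 := P.mesh_pos 0
  by_cases hb : Inside S b
  · rw [if_pos (show b.src ∈ S ∧ b.src.shift b.dir ∈ S from hb), if_pos hb]
    unfold covDeriv
    rw [norm_smul, Real.norm_eq_abs, abs_of_pos (inv_pos.2 hm), ← mul_assoc, mul_inv_cancel₀ hm.ne', one_mul,
      norm_sub_rev (v b.src)]
    rfl
  · rw [if_neg (show ¬ (b.src ∈ S ∧ b.src.shift b.dir ∈ S) from hb), if_neg hb, norm_zero]

/-- **THE FORWARD NEUMANN DIFFERENCES SQUARE-SUM TO THE DIRICHLET FORM**: `Σ_x ε^d Σ_μ ‖fwd_μv(x)‖² = ε²⟨v, −Δ^N_{A′,S}v⟩`.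
[cite: Balaban1982Higgs1, (2.17) p.610] -/
theorem sum_sq_fwdTerm_eq (v : ScalarField P 0 N) :
    ∑ x : HiggsLattice.Site P 0, P.mesh 0 ^ P.d * ∑ μ : Fin P.d, ‖fwdTerm C S A' x μ v‖ ^ 2
      = P.mesh 0 ^ 2 * siteInner v (covLaplacianN C S A' v) := by
  rw [siteInner_covLaplacianN]
  simp_rw [Finset.mul_sum]
  rw [sum_site_dir (fun x μ => P.mesh 0 ^ P.d * ‖fwdTerm C S A' x μ v‖ ^ 2)]
  refine Finset.sum_congr rfl fun b _ => ?_
  rw [norm_fwdTerm_eq]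
  split_ifs with hb
  · rw [real_inner_self_eq_norm_sq]; ring
  · simp

/-- The backward differences have the same square-sum (translation by `εe_μ` is a bijection of `T_ε`). [cite: Balaban1982Higgs1, (2.17) p.610] -/
theorem sum_sq_bwdTerm_eq (v : ScalarField P 0 N) :
    ∑ x : HiggsLattice.Site P 0, P.mesh 0 ^ P.d * ∑ μ : Fin P.d, ‖bwdTerm C S A' x μ v‖ ^ 2
      = P.mesh 0 ^ 2 * siteInner v (covLaplacianN C S A' v) := by
  rw [← sum_sq_fwdTerm_eq]
  simp_rw [Finset.mul_sum, norm_bwdTerm_eq]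
  calc ∑ x : HiggsLattice.Site P 0, ∑ μ : Fin P.d, P.mesh 0 ^ P.d * ‖fwdTerm C S A' (x.unshift μ) μ v‖ ^ 2
      = ∑ μ : Fin P.d, ∑ x : HiggsLattice.Site P 0, P.mesh 0 ^ P.d * ‖fwdTerm C S A' (x.unshift μ) μ v‖ ^ 2 :=
        Finset.sum_comm
    _ = ∑ μ : Fin P.d, ∑ x : HiggsLattice.Site P 0, P.mesh 0 ^ P.d * ‖fwdTerm C S A' x μ v‖ ^ 2 := by
        refine Finset.sum_congr rfl fun μ _ => ?_
        exact Fintype.sum_equiv (shiftEquiv P 0 μ).symm _ _ (fun x => rfl)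
    _ = ∑ x : HiggsLattice.Site P 0, ∑ μ : Fin P.d, P.mesh 0 ^ P.d * ‖fwdTerm C S A' x μ v‖ ^ 2 := Finset.sum_comm

/-- **THE GRADIENT TERM OF (2.10) IN `L²`**: for `|h(x) − h(x+εe_μ)| ≤ σ₁` on all bonds,
`‖Σ_μ((h(x) − h(x+εe_μ))fwd_μv + (h(x) − h(x−εe_μ))bwd_μv)‖₂ ≤ 2σ₁ε·(d·⟨v, −Δ^N_{A′,S}v⟩)^{1/2}` (Cauchy–Schwarz over the `2d`
terms, then the square-sums above). [cite: Balaban1983RegularityDecay, (2.10) p.576, Lemma 2.1 p.577] -/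
theorem sNorm_gradComm_le {h : HiggsLattice.Site P 0 → ℝ} {σ₁ : ℝ} (hσ₁ : 0 ≤ σ₁)
    (h1 : ∀ x μ, |h x - h (x.shift μ)| ≤ σ₁) (v : ScalarField P 0 N) :
    sNorm (fun x => ∑ μ : Fin P.d, ((h x - h (x.shift μ)) • fwdTerm C S A' x μ v
        + (h x - h (x.unshift μ)) • bwdTerm C S A' x μ v))
      ≤ 2 * σ₁ * P.mesh 0 * Real.sqrt (P.d * siteInner v (covLaplacianN C S A' v)) := by
  have hm : 0 ≤ P.mesh 0 ^ P.d := pow_nonneg (P.mesh_pos 0).le _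
  have h1' : ∀ x μ, |h x - h (x.unshift μ)| ≤ σ₁ := fun x μ => by
    have h0 := h1 (x.unshift μ) μ
    rw [shift_unshift] at h0
    rwa [abs_sub_comm]
  -- pointwise
  have hpt : ∀ x, ‖∑ μ : Fin P.d, ((h x - h (x.shift μ)) • fwdTerm C S A' x μ v
      + (h x - h (x.unshift μ)) • bwdTerm C S A' x μ v)‖
      ≤ σ₁ * ∑ μ : Fin P.d, (‖fwdTerm C S A' x μ v‖ + ‖bwdTerm C S A' x μ v‖) := by
    intro x
    rw [Finset.mul_sum]
    refine (norm_sum_le _ _).trans (Finset.sum_le_sum fun μ _ => ?_)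
    refine (norm_add_le _ _).trans ?_
    rw [norm_smul, norm_smul, Real.norm_eq_abs, Real.norm_eq_abs, mul_add]
    exact add_le_add (mul_le_mul_of_nonneg_right (h1 x μ) (norm_nonneg _))
      (mul_le_mul_of_nonneg_right (h1' x μ) (norm_nonneg _))
  -- squares
  have hsq : ∀ x, ‖∑ μ : Fin P.d, ((h x - h (x.shift μ)) • fwdTerm C S A' x μ v
      + (h x - h (x.unshift μ)) • bwdTerm C S A' x μ v)‖ ^ 2
      ≤ σ₁ ^ 2 * (2 * P.d * ∑ μ : Fin P.d, (‖fwdTerm C S A' x μ v‖ ^ 2 + ‖bwdTerm C S A' x μ v‖ ^ 2)) := by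
    intro x
    have hF : (∑ μ : Fin P.d, (‖fwdTerm C S A' x μ v‖ + ‖bwdTerm C S A' x μ v‖)) ^ 2
        ≤ P.d * ∑ μ : Fin P.d, (‖fwdTerm C S A' x μ v‖ + ‖bwdTerm C S A' x μ v‖) ^ 2 := by
      have h0 := sq_sum_le_card_mul_sum_sq (s := (Finset.univ : Finset (Fin P.d)))
        (f := fun μ => ‖fwdTerm C S A' x μ v‖ + ‖bwdTerm C S A' x μ v‖)
      rwa [Finset.card_univ, Fintype.card_fin] at h0
    have hF2 : ∑ μ : Fin P.d, (‖fwdTerm C S A' x μ v‖ + ‖bwdTerm C S A' x μ v‖) ^ 2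
        ≤ ∑ μ : Fin P.d, 2 * (‖fwdTerm C S A' x μ v‖ ^ 2 + ‖bwdTerm C S A' x μ v‖ ^ 2) :=
      Finset.sum_le_sum fun μ _ => add_sq_le' _ _
    have hd : (0 : ℝ) ≤ P.d := Nat.cast_nonneg _
    calc ‖∑ μ : Fin P.d, ((h x - h (x.shift μ)) • fwdTerm C S A' x μ v + (h x - h (x.unshift μ)) • bwdTerm C S A' x μ v)‖ ^ 2
        ≤ (σ₁ * ∑ μ : Fin P.d, (‖fwdTerm C S A' x μ v‖ + ‖bwdTerm C S A' x μ v‖)) ^ 2 :=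
          pow_le_pow_left₀ (norm_nonneg _) (hpt x) 2
      _ = σ₁ ^ 2 * (∑ μ : Fin P.d, (‖fwdTerm C S A' x μ v‖ + ‖bwdTerm C S A' x μ v‖)) ^ 2 := by ring
      _ ≤ σ₁ ^ 2 * (P.d * ∑ μ : Fin P.d, (‖fwdTerm C S A' x μ v‖ + ‖bwdTerm C S A' x μ v‖) ^ 2) :=
          mul_le_mul_of_nonneg_left hF (sq_nonneg _)
      _ ≤ σ₁ ^ 2 * (P.d * ∑ μ : Fin P.d, 2 * (‖fwdTerm C S A' x μ v‖ ^ 2 + ‖bwdTerm C S A' x μ v‖ ^ 2)) :=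
          mul_le_mul_of_nonneg_left (mul_le_mul_of_nonneg_left hF2 hd) (sq_nonneg _)
      _ = σ₁ ^ 2 * (2 * P.d * ∑ μ : Fin P.d, (‖fwdTerm C S A' x μ v‖ ^ 2 + ‖bwdTerm C S A' x μ v‖ ^ 2)) := by
          rw [← Finset.mul_sum]; ring
  -- total
  have htot : ∑ x : HiggsLattice.Site P 0, P.mesh 0 ^ P.d *
      ‖∑ μ : Fin P.d, ((h x - h (x.shift μ)) • fwdTerm C S A' x μ v + (h x - h (x.unshift μ)) • bwdTerm C S A' x μ v)‖ ^ 2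
      ≤ (2 * σ₁ * P.mesh 0) ^ 2 * (P.d * siteInner v (covLaplacianN C S A' v)) := by
    calc ∑ x : HiggsLattice.Site P 0, P.mesh 0 ^ P.d *
          ‖∑ μ : Fin P.d, ((h x - h (x.shift μ)) • fwdTerm C S A' x μ v + (h x - h (x.unshift μ)) • bwdTerm C S A' x μ v)‖ ^ 2
        ≤ ∑ x : HiggsLattice.Site P 0, P.mesh 0 ^ P.d *
            (σ₁ ^ 2 * (2 * P.d * ∑ μ : Fin P.d, (‖fwdTerm C S A' x μ v‖ ^ 2 + ‖bwdTerm C S A' x μ v‖ ^ 2))) :=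
          Finset.sum_le_sum fun x _ => mul_le_mul_of_nonneg_left (hsq x) hm
      _ = ∑ x : HiggsLattice.Site P 0, σ₁ ^ 2 * (2 * P.d) *
            (P.mesh 0 ^ P.d * ∑ μ : Fin P.d, ‖fwdTerm C S A' x μ v‖ ^ 2
              + P.mesh 0 ^ P.d * ∑ μ : Fin P.d, ‖bwdTerm C S A' x μ v‖ ^ 2) := by
          refine Finset.sum_congr rfl fun x _ => ?_
          rw [Finset.sum_add_distrib]; ring
      _ = σ₁ ^ 2 * (2 * P.d) *
            (∑ x : HiggsLattice.Site P 0, P.mesh 0 ^ P.d * ∑ μ : Fin P.d, ‖fwdTerm C S A' x μ v‖ ^ 2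
              + ∑ x : HiggsLattice.Site P 0, P.mesh 0 ^ P.d * ∑ μ : Fin P.d, ‖bwdTerm C S A' x μ v‖ ^ 2) := by
          rw [← Finset.mul_sum, Finset.sum_add_distrib]
      _ = (2 * σ₁ * P.mesh 0) ^ 2 * (P.d * siteInner v (covLaplacianN C S A' v)) := by
          rw [sum_sq_fwdTerm_eq, sum_sq_bwdTerm_eq]; ring
  have h := sNorm_le_sqrt htot
  have h2σ : 0 ≤ 2 * σ₁ * P.mesh 0 := mul_nonneg (mul_nonneg zero_le_two hσ₁) (P.mesh_pos 0).le
  rwa [Real.sqrt_mul (sq_nonneg _), Real.sqrt_sq h2σ] at h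

/-- **THE COMMUTATOR `[P_K(A′), h]` AT A SITE**: `([P_K, h]v)(x) = U(A′(Γ_x))*·L^{−Kd}Σ_{x′ ∈ B^K(x)} U(A′(Γ_{x′}))((h(x′) − h(x))v(x′))`
(the third term of (2.10) for the carrier's block averaging (2.11)/(2.20)). [cite: Balaban1983RegularityDecay, (2.10) p.576]
[cite: Balaban1982Higgs1, (2.20) p.610] -/
theorem projPk_comm_apply (h : HiggsLattice.Site P 0 → ℝ) (v : ScalarField P 0 N) (x : HiggsLattice.Site P 0) :
    (projPk C A' K (h • v) - h • projPk C A' K v) x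
      = star (C.U (P.mesh 0) (multiContourSum A' K x))
          ((((P.L : ℝ) ^ (K * P.d))⁻¹) • ∑ x' ∈ blockK K (blockIter K x),
            C.U (P.mesh 0) (multiContourSum A' K x') ((h x' - h x) • v x')) := by
  rw [Pi.sub_apply, Pi.smul_apply', projPk_apply, projPk_apply,
    ← map_smul (star (C.U (P.mesh 0) (multiContourSum A' K x))) (h x), ← map_sub,
    smul_comm (h x) (((P.L : ℝ) ^ (K * P.d))⁻¹), ← smul_sub, Finset.smul_sum, ← Finset.sum_sub_distrib]
  congr 2
  refine Finset.sum_congr rfl fun x' _ => ?_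
  rw [Pi.smul_apply', map_smul, map_smul, sub_smul]

/-- `‖([P_K, h]v)(x)‖ ≤ σ₃·L^{−Kd}Σ_{x′ ∈ B^K(x)}‖v(x′)‖` when `h` oscillates by at most `σ₃` on `K`-blocks.
[cite: Balaban1983RegularityDecay, (2.10) p.576] -/
theorem norm_projPk_comm_apply_le {h : HiggsLattice.Site P 0 → ℝ} {σ₃ : ℝ}
    (h3 : ∀ x x' : HiggsLattice.Site P 0, blockIter K x = blockIter K x' → |h x - h x'| ≤ σ₃)
    (v : ScalarField P 0 N) (x : HiggsLattice.Site P 0) :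
    ‖(projPk C A' K (h • v) - h • projPk C A' K v) x‖
      ≤ σ₃ * ((((P.L : ℝ) ^ (K * P.d))⁻¹) * ∑ x' ∈ blockK K (blockIter K x), ‖v x'‖) := by
  have hc0 : 0 ≤ ((P.L : ℝ) ^ (K * P.d))⁻¹ := inv_nonneg.2 (pow_nonneg (Nat.cast_nonneg _) _)
  rw [projPk_comm_apply, ChargeData.star_U, norm_U_apply, norm_smul, Real.norm_eq_abs, abs_of_nonneg hc0]
  calc ((P.L : ℝ) ^ (K * P.d))⁻¹ * ‖∑ x' ∈ blockK K (blockIter K x), C.U (P.mesh 0) (multiContourSum A' K x') ((h x' - h x) • v x')‖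
      ≤ ((P.L : ℝ) ^ (K * P.d))⁻¹ * ∑ x' ∈ blockK K (blockIter K x), ‖C.U (P.mesh 0) (multiContourSum A' K x') ((h x' - h x) • v x')‖ :=
        mul_le_mul_of_nonneg_left (norm_sum_le _ _) hc0
    _ = ((P.L : ℝ) ^ (K * P.d))⁻¹ * ∑ x' ∈ blockK K (blockIter K x), |h x' - h x| * ‖v x'‖ := by
        congr 1
        refine Finset.sum_congr rfl fun x' _ => ?_
        rw [norm_U_apply, norm_smul, Real.norm_eq_abs]
    _ ≤ ((P.L : ℝ) ^ (K * P.d))⁻¹ * ∑ x' ∈ blockK K (blockIter K x), σ₃ * ‖v x'‖ :=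
        mul_le_mul_of_nonneg_left (Finset.sum_le_sum fun x' hx' =>
          mul_le_mul_of_nonneg_right (h3 x' x ((mem_blockK K _ x').1 hx')) (norm_nonneg _)) hc0
    _ = σ₃ * ((((P.L : ℝ) ^ (K * P.d))⁻¹) * ∑ x' ∈ blockK K (blockIter K x), ‖v x'‖) := by
        rw [← Finset.mul_sum]; ring

/-- **THE BLOCK-AVERAGE TERM OF (2.10) IN `L²`** (Jensen on each block, `|B^K(y)| = L^{Kd}`): `‖[P_K(A′), h]v‖₂ ≤ σ₃‖v‖₂`.
[cite: Balaban1983RegularityDecay, (2.10) p.576, Lemma 2.1 p.577] -/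
theorem sNorm_projPk_comm_le (hK : K ≤ P.K) {h : HiggsLattice.Site P 0 → ℝ} {σ₃ : ℝ} (hσ₃ : 0 ≤ σ₃)
    (h3 : ∀ x x' : HiggsLattice.Site P 0, blockIter K x = blockIter K x' → |h x - h x'| ≤ σ₃)
    (v : ScalarField P 0 N) :
    sNorm (projPk C A' K (h • v) - h • projPk C A' K v) ≤ σ₃ * sNorm v := by
  have hm : 0 ≤ P.mesh 0 ^ P.d := pow_nonneg (P.mesh_pos 0).le _
  set c : ℝ := ((P.L : ℝ) ^ (K * P.d))⁻¹ with hc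
  have hL : (0 : ℝ) < (P.L : ℝ) ^ (K * P.d) := pow_pos (by exact_mod_cast P.hL) _
  have hc0 : 0 ≤ c := inv_nonneg.2 hL.le
  have hcL : c * (P.L : ℝ) ^ (K * P.d) = 1 := inv_mul_cancel₀ hL.ne'
  -- Jensen on a block
  have hJ : ∀ x : HiggsLattice.Site P 0,
      (c * ∑ x' ∈ blockK K (blockIter K x), ‖v x'‖) ^ 2 ≤ c * ∑ x' ∈ blockK K (blockIter K x), ‖v x'‖ ^ 2 := by
    intro x
    have hcs := sq_sum_le_card_mul_sum_sq (s := blockK K (blockIter K x)) (f := fun x' => ‖v x'‖)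
    rw [card_blockK hK] at hcs
    push_cast at hcs
    calc (c * ∑ x' ∈ blockK K (blockIter K x), ‖v x'‖) ^ 2
        = c * (c * (∑ x' ∈ blockK K (blockIter K x), ‖v x'‖) ^ 2) := by ring
      _ ≤ c * (c * ((P.L : ℝ) ^ (K * P.d) * ∑ x' ∈ blockK K (blockIter K x), ‖v x'‖ ^ 2)) :=
          mul_le_mul_of_nonneg_left (mul_le_mul_of_nonneg_left hcs hc0) hc0
      _ = c * ∑ x' ∈ blockK K (blockIter K x), ‖v x'‖ ^ 2 := by
          linear_combination (c * ∑ x' ∈ blockK K (blockIter K x), ‖v x'‖ ^ 2) * hcL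
  -- summing the block averages of `‖v‖²` over the torus gives `‖v‖²`
  have hsum : ∑ x : HiggsLattice.Site P 0, P.mesh 0 ^ P.d * (c * ∑ x' ∈ blockK K (blockIter K x), ‖v x'‖ ^ 2)
      = ∑ x : HiggsLattice.Site P 0, P.mesh 0 ^ P.d * ‖v x‖ ^ 2 := by
    rw [← sum_blockK_sum' K (fun x => P.mesh 0 ^ P.d * (c * ∑ x' ∈ blockK K (blockIter K x), ‖v x'‖ ^ 2)),
      ← sum_blockK_sum' K (fun x => P.mesh 0 ^ P.d * ‖v x‖ ^ 2)]
    refine Finset.sum_congr rfl fun y _ => ?_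
    have hin : ∀ x ∈ blockK K y, P.mesh 0 ^ P.d * (c * ∑ x' ∈ blockK K (blockIter K x), ‖v x'‖ ^ 2)
        = P.mesh 0 ^ P.d * (c * ∑ x' ∈ blockK K y, ‖v x'‖ ^ 2) := by
      intro x hx
      rw [(mem_blockK K y x).1 hx]
    rw [Finset.sum_congr rfl hin, Finset.sum_const, card_blockK hK, nsmul_eq_mul, ← Finset.mul_sum]
    push_cast
    linear_combination (P.mesh 0 ^ P.d * ∑ i ∈ blockK K y, ‖v i‖ ^ 2) * hcL
  have htot : ∑ x : HiggsLattice.Site P 0, P.mesh 0 ^ P.d * ‖(projPk C A' K (h • v) - h • projPk C A' K v) x‖ ^ 2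
      ≤ σ₃ ^ 2 * siteInner v v := by
    calc ∑ x : HiggsLattice.Site P 0, P.mesh 0 ^ P.d * ‖(projPk C A' K (h • v) - h • projPk C A' K v) x‖ ^ 2
        ≤ ∑ x : HiggsLattice.Site P 0, P.mesh 0 ^ P.d * (σ₃ ^ 2 * (c * ∑ x' ∈ blockK K (blockIter K x), ‖v x'‖ ^ 2)) := by
          refine Finset.sum_le_sum fun x _ => mul_le_mul_of_nonneg_left ?_ hm
          calc ‖(projPk C A' K (h • v) - h • projPk C A' K v) x‖ ^ 2
              ≤ (σ₃ * (c * ∑ x' ∈ blockK K (blockIter K x), ‖v x'‖)) ^ 2 :=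
                pow_le_pow_left₀ (norm_nonneg _) (norm_projPk_comm_apply_le C A' h3 v x) 2
            _ = σ₃ ^ 2 * (c * ∑ x' ∈ blockK K (blockIter K x), ‖v x'‖) ^ 2 := by ring
            _ ≤ σ₃ ^ 2 * (c * ∑ x' ∈ blockK K (blockIter K x), ‖v x'‖ ^ 2) :=
                mul_le_mul_of_nonneg_left (hJ x) (sq_nonneg _)
      _ = σ₃ ^ 2 * ∑ x : HiggsLattice.Site P 0, P.mesh 0 ^ P.d * (c * ∑ x' ∈ blockK K (blockIter K x), ‖v x'‖ ^ 2) := by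
          rw [Finset.mul_sum]
          exact Finset.sum_congr rfl fun x _ => by ring
      _ = σ₃ ^ 2 * siteInner v v := by rw [hsum, siteInner_self_eq]
  have h := sNorm_le_sqrt htot
  rwa [Real.sqrt_mul (sq_nonneg _), Real.sqrt_sq hσ₃, ← sNorm_sq, Real.sqrt_sq (sNorm_nonneg v)] at h

/-- `‖−f‖₂ = ‖f‖₂`. [cite: Balaban1982Higgs1, (1.5) p.604] -/
private theorem sNorm_neg' {k : ℕ} (f : ScalarField P k N) : sNorm (-f) = sNorm f := by
  rw [← neg_one_smul ℝ f, sNorm_smul, abs_neg, abs_one, one_mul]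

/-- `‖f − g‖₂ ≤ ‖f‖₂ + ‖g‖₂`. [cite: Balaban1982Higgs1, (1.5) p.604] -/
private theorem sNorm_sub_le' {k : ℕ} (f g : ScalarField P k N) : sNorm (f - g) ≤ sNorm f + sNorm g := by
  rw [sub_eq_add_neg]
  exact (sNorm_add_le f (-g)).trans (by rw [sNorm_neg'])

/-- **THE LAPLACIAN PART OF (2.10) IN `L²`**: for `|∂h| ≤ σ₁` on bonds and `|Δ^N_Sh| ≤ σ₂`,
`‖[−Δ^{ε,N}_{A′,S}, h]v‖₂ ≤ ε⁻²(σ₂‖v‖₂ + 2σ₁ε(d⟨v, −Δ^N_Sv⟩)^{1/2})`. [cite: Balaban1983RegularityDecay, (2.10) p.576, Lemma 2.1 p.577] -/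
theorem sNorm_lapComm_le {h : HiggsLattice.Site P 0 → ℝ} {σ₁ σ₂ : ℝ} (hσ₁ : 0 ≤ σ₁) (hσ₂ : 0 ≤ σ₂)
    (h1 : ∀ x μ, |h x - h (x.shift μ)| ≤ σ₁)
    (h2 : ∀ x : HiggsLattice.Site P 0, |∑ μ : Fin P.d, ((if x ∈ S ∧ x.shift μ ∈ S then h x - h (x.shift μ) else 0)
        + (if x ∈ S ∧ x.unshift μ ∈ S then h x - h (x.unshift μ) else 0))| ≤ σ₂)
    (v : ScalarField P 0 N) :
    sNorm (covLaplacianN C S A' (h • v) - h • covLaplacianN C S A' v)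
      ≤ (P.mesh 0)⁻¹ ^ 2 * (σ₂ * sNorm v + 2 * σ₁ * P.mesh 0 * Real.sqrt (P.d * siteInner v (covLaplacianN C S A' v))) := by
  have heq : covLaplacianN C S A' (h • v) - h • covLaplacianN C S A' v
      = ((P.mesh 0)⁻¹ ^ 2) •
        ((fun x => (∑ μ : Fin P.d, ((if x ∈ S ∧ x.shift μ ∈ S then h x - h (x.shift μ) else 0)
            + (if x ∈ S ∧ x.unshift μ ∈ S then h x - h (x.unshift μ) else 0))) • v x)
          - (fun x => ∑ μ : Fin P.d, ((h x - h (x.shift μ)) • fwdTerm C S A' x μ v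
              + (h x - h (x.unshift μ)) • bwdTerm C S A' x μ v))) := by
    funext x
    rw [covLaplacianN_comm_apply]
    rfl
  have hN : sNorm (fun x => (∑ μ : Fin P.d, ((if x ∈ S ∧ x.shift μ ∈ S then h x - h (x.shift μ) else 0)
      + (if x ∈ S ∧ x.unshift μ ∈ S then h x - h (x.unshift μ) else 0))) • v x) ≤ σ₂ * sNorm v :=
    sNorm_le_of_norm_le hσ₂ fun x => by
      rw [norm_smul, Real.norm_eq_abs]
      exact mul_le_mul_of_nonneg_right (h2 x) (norm_nonneg _)
  have hT := sNorm_gradComm_le C S A' hσ₁ h1 v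
  rw [heq, sNorm_smul, abs_of_nonneg (sq_nonneg _)]
  exact mul_le_mul_of_nonneg_left ((sNorm_sub_le' _ _).trans (add_le_add hN hT)) (sq_nonneg _)

/-- **THE COMMUTATOR OF THE FULL OPERATOR (2.20) SPLITS** into its Laplacian and block-average parts (the mass term commutes with `h`):
`[H_K(S,A′), h] = [−Δ^N_{A′,S}, h] + a_K(L^Kε)^{−2}[P_K(A′), h]`. [cite: Balaban1983RegularityDecay, (2.10) p.576] -/
theorem covOpK_comm_eq (msq a : ℝ) (h : HiggsLattice.Site P 0 → ℝ) (v : ScalarField P 0 N) :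
    covOpK C S A' msq a K (h • v) - h • covOpK C S A' msq a K v
      = (covLaplacianN C S A' (h • v) - h • covLaplacianN C S A' v)
        + (B1.aSeq a P.L K * ((P.mesh K)⁻¹ ^ 2)) • (projPk C A' K (h • v) - h • projPk C A' K v) := by
  funext x
  simp only [covOpK, LinearMap.add_apply, LinearMap.smul_apply, LinearMap.id_coe, id_eq, Pi.add_apply, Pi.sub_apply,
    Pi.smul_apply, Pi.smul_apply']
  rw [smul_add, smul_add, smul_comm (h x) msq (v x),
    smul_comm (h x) (B1.aSeq a P.L K * (P.mesh K)⁻¹ ^ 2) (projPk C A' K v x), smul_sub]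
  abel

/-- **(2.10) IN `L²` FOR THE CARRIER, any `v`**: `‖[H_K(S,A′), h]v‖₂ ≤ ε⁻²(σ₂‖v‖₂ + 2σ₁ε(d⟨v,−Δ^N_Sv⟩)^{1/2}) + a_K(L^Kε)^{−2}σ₃‖v‖₂`
(`K ≤ K_P`, `a_K ≥ 0`; `h` with `|∂h| ≤ σ₁`, `|Δ^N_Sh| ≤ σ₂`, block oscillation `≤ σ₃`). [cite: Balaban1983RegularityDecay, (2.10) p.576] -/
theorem sNorm_comm_le (hK : K ≤ P.K) {msq a : ℝ} (hak : 0 ≤ B1.aSeq a P.L K) {h : HiggsLattice.Site P 0 → ℝ}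
    {σ₁ σ₂ σ₃ : ℝ} (hσ₁ : 0 ≤ σ₁) (hσ₂ : 0 ≤ σ₂) (hσ₃ : 0 ≤ σ₃)
    (h1 : ∀ x μ, |h x - h (x.shift μ)| ≤ σ₁)
    (h2 : ∀ x : HiggsLattice.Site P 0, |∑ μ : Fin P.d, ((if x ∈ S ∧ x.shift μ ∈ S then h x - h (x.shift μ) else 0)
        + (if x ∈ S ∧ x.unshift μ ∈ S then h x - h (x.unshift μ) else 0))| ≤ σ₂)
    (h3 : ∀ x x' : HiggsLattice.Site P 0, blockIter K x = blockIter K x' → |h x - h x'| ≤ σ₃)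
    (v : ScalarField P 0 N) :
    sNorm (covOpK C S A' msq a K (h • v) - h • covOpK C S A' msq a K v)
      ≤ (P.mesh 0)⁻¹ ^ 2 * (σ₂ * sNorm v + 2 * σ₁ * P.mesh 0 * Real.sqrt (P.d * siteInner v (covLaplacianN C S A' v)))
        + B1.aSeq a P.L K * ((P.mesh K)⁻¹ ^ 2) * (σ₃ * sNorm v) := by
  have hc : 0 ≤ B1.aSeq a P.L K * ((P.mesh K)⁻¹ ^ 2) := mul_nonneg hak (sq_nonneg _)
  rw [covOpK_comm_eq]
  refine (sNorm_add_le _ _).trans (add_le_add (sNorm_lapComm_le C S A' hσ₁ hσ₂ h1 h2 v) ?_)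
  rw [sNorm_smul, abs_of_nonneg hc]
  exact mul_le_mul_of_nonneg_left (sNorm_projPk_comm_le C A' hK hσ₃ h3 v) hc

/-- **THE `‖·‖_{2,2}` LETTER `‖K_hG_k(□, A)·‖_{2,2} ≤ c₂O(1)M⁻¹` (the factor of (2.21)) FOR THE CARRIER, from a coercivity constant**: for `S`
a union of `K`-blocks
(`K ≤ K_P`), `m² > 0`, `a_K ≥ 0`, a field `A′` with `γ(L^Kε)^{−2}‖w‖² ≤ ⟨w, H_K(S,A′)w⟩` on `S`-supported `w`, a multiplier `h` with
`|∂h| ≤ σ₁`, `|Δ^N_Sh| ≤ σ₂`, block oscillation `≤ σ₃`, and `ψ` supported in `S`: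
`‖[H_K(S,A′), h]G_K(S,A′)ψ‖₂ ≤ (σ₂γ⁻¹L^{2K} + 2σ₁(dγ⁻¹)^{1/2}L^K + a_Kσ₃γ⁻¹)‖ψ‖₂` — Lemma 2.1 (2.15) fed into (2.10).
[cite: Balaban1983RegularityDecay, (2.10) p.576, Lemma 2.1 (2.15) p.577, (2.21) p.578] -/
theorem sNorm_comm_propagatorK_le (hK : K ≤ P.K)
    (hS : ∀ x x' : HiggsLattice.Site P 0, blockIter K x = blockIter K x' → (x ∈ S ↔ x' ∈ S))
    {msq a : ℝ} (hmsq : 0 < msq) (hak : 0 ≤ B1.aSeq a P.L K) {γ : ℝ} (hγ : 0 < γ)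
    (hlow : ∀ w : ScalarField P 0 N, (∀ x, x ∉ S → w x = 0) →
      γ * ((P.mesh K)⁻¹ ^ 2) * siteInner w w ≤ siteInner w (covOpK C S A' msq a K w))
    {h : HiggsLattice.Site P 0 → ℝ} {σ₁ σ₂ σ₃ : ℝ} (hσ₁ : 0 ≤ σ₁) (hσ₂ : 0 ≤ σ₂) (hσ₃ : 0 ≤ σ₃)
    (h1 : ∀ x μ, |h x - h (x.shift μ)| ≤ σ₁)
    (h2 : ∀ x : HiggsLattice.Site P 0, |∑ μ : Fin P.d, ((if x ∈ S ∧ x.shift μ ∈ S then h x - h (x.shift μ) else 0)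
        + (if x ∈ S ∧ x.unshift μ ∈ S then h x - h (x.unshift μ) else 0))| ≤ σ₂)
    (h3 : ∀ x x' : HiggsLattice.Site P 0, blockIter K x = blockIter K x' → |h x - h x'| ≤ σ₃)
    (ψ : ScalarField P 0 N) (hψ : ∀ x, x ∉ S → ψ x = 0) :
    sNorm (covOpK C S A' msq a K (h • propagatorK C S A' msq a K ψ)
        - h • covOpK C S A' msq a K (propagatorK C S A' msq a K ψ))
      ≤ (σ₂ * γ⁻¹ * ((P.L : ℝ) ^ K) ^ 2 + 2 * σ₁ * Real.sqrt (P.d * γ⁻¹) * (P.L : ℝ) ^ K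
          + B1.aSeq a P.L K * σ₃ * γ⁻¹) * sNorm ψ := by
  obtain ⟨hval, hdir⟩ := lemma21_of_coercive C S A' hS hmsq hak hγ hlow ψ hψ
  set v := propagatorK C S A' msq a K ψ with hv
  have h0 := sNorm_comm_le C S A' hK hak hσ₁ hσ₂ hσ₃ h1 h2 h3 v (msq := msq)
  have hm0 : 0 < P.mesh 0 := P.mesh_pos 0
  have hmK : 0 < P.mesh K := P.mesh_pos K
  have hmesh : P.mesh K = (P.L : ℝ) ^ K * P.mesh 0 := mesh_eq K
  have hψ0 : 0 ≤ sNorm ψ := sNorm_nonneg ψ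
  have hd : (0 : ℝ) ≤ P.d := Nat.cast_nonneg _
  have hγ' : 0 ≤ γ⁻¹ := inv_nonneg.2 hγ.le
  -- the Dirichlet member under the square root
  have hsq : Real.sqrt (P.d * siteInner v (covLaplacianN C S A' v)) ≤ Real.sqrt (P.d * γ⁻¹) * P.mesh K * sNorm ψ := by
    have h1' : Real.sqrt (P.d * siteInner v (covLaplacianN C S A' v))
        ≤ Real.sqrt (P.d * (γ⁻¹ * P.mesh K ^ 2 * sNorm ψ ^ 2)) :=
      Real.sqrt_le_sqrt (mul_le_mul_of_nonneg_left hdir hd)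
    have e : (P.d : ℝ) * (γ⁻¹ * P.mesh K ^ 2 * sNorm ψ ^ 2) = (P.d * γ⁻¹) * (P.mesh K * sNorm ψ) ^ 2 := by ring
    rw [e, Real.sqrt_mul (mul_nonneg hd hγ'), Real.sqrt_sq (mul_nonneg hmK.le hψ0), ← mul_assoc] at h1'
    exact h1'
  -- substitute the two members of (2.15)
  have hA : σ₂ * sNorm v ≤ σ₂ * (γ⁻¹ * P.mesh K ^ 2 * sNorm ψ) := mul_le_mul_of_nonneg_left hval hσ₂
  have hB : 2 * σ₁ * P.mesh 0 * Real.sqrt (P.d * siteInner v (covLaplacianN C S A' v))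
      ≤ 2 * σ₁ * P.mesh 0 * (Real.sqrt (P.d * γ⁻¹) * P.mesh K * sNorm ψ) :=
    mul_le_mul_of_nonneg_left hsq (mul_nonneg (mul_nonneg zero_le_two hσ₁) hm0.le)
  have hC : σ₃ * sNorm v ≤ σ₃ * (γ⁻¹ * P.mesh K ^ 2 * sNorm ψ) := mul_le_mul_of_nonneg_left hval hσ₃
  have hc : 0 ≤ B1.aSeq a P.L K * ((P.mesh K)⁻¹ ^ 2) := mul_nonneg hak (sq_nonneg _)
  calc sNorm (covOpK C S A' msq a K (h • v) - h • covOpK C S A' msq a K v)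
      ≤ (P.mesh 0)⁻¹ ^ 2 * (σ₂ * sNorm v + 2 * σ₁ * P.mesh 0 * Real.sqrt (P.d * siteInner v (covLaplacianN C S A' v)))
        + B1.aSeq a P.L K * ((P.mesh K)⁻¹ ^ 2) * (σ₃ * sNorm v) := h0
    _ ≤ (P.mesh 0)⁻¹ ^ 2 * (σ₂ * (γ⁻¹ * P.mesh K ^ 2 * sNorm ψ)
          + 2 * σ₁ * P.mesh 0 * (Real.sqrt (P.d * γ⁻¹) * P.mesh K * sNorm ψ))
        + B1.aSeq a P.L K * ((P.mesh K)⁻¹ ^ 2) * (σ₃ * (γ⁻¹ * P.mesh K ^ 2 * sNorm ψ)) :=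
        add_le_add (mul_le_mul_of_nonneg_left (add_le_add hA hB) (sq_nonneg _)) (mul_le_mul_of_nonneg_left hC hc)
    _ = (σ₂ * γ⁻¹ * ((P.L : ℝ) ^ K) ^ 2 + 2 * σ₁ * Real.sqrt (P.d * γ⁻¹) * (P.L : ℝ) ^ K
          + B1.aSeq a P.L K * σ₃ * γ⁻¹) * sNorm ψ := by
        have hL0 : (P.L : ℝ) ≠ 0 := (show (0 : ℝ) < P.L by exact_mod_cast P.hL).ne'
        rw [hmesh]
        field_simp

end Commutator

/-! ## §4 The boundary pieces of a big-block region at a (2.23)-regular `A` -/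

section BoundaryPieces

variable (C : ChargeData N) {K K₀ : ℕ}

/-- **(1.8) ON A PIECE `Ω ∩ □_j`**: for `Ω` a big-block union the pieces are unions of `K`-blocks, so r14's coercivity at a
(2.23)-regular `A` applies to `H_K(Ω ∩ □_j, A)`: `γ₀(L^Kε)^{−2}‖w‖² + m²‖w‖² ≤ ⟨w, H_K(Ω ∩ □_j, A)w⟩` for `w` supported in the piece
(`γ₀ = min{2, a(1 − L⁻²)/4}`). [cite: Balaban1983RegularityDecay, (1.8) p.573, Lemma 2.1 p.577] -/
theorem coercive_piece {a : ℝ} (ha : 0 < a) (hL : 1 < P.L) (hK1 : 1 ≤ K) (hK : K ≤ P.K) (hK₀ : K₀ ∣ P.M) (hK₀8 : 8 ≤ K₀)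
    (hN3 : ∀ μ, 3 * half P K K₀ ≤ P.sitesPerDir 0 μ) {Ω : Finset (HiggsLattice.Site P 0)} (hΩ : IsBigBlockUnion K K₀ Ω)
    (A : HiggsLattice.VecField P 0) {creg β ec : ℝ} (hec : 0 < ec)
    (hreg : ∀ z ∈ Ω, ∀ μ ν : Fin P.d,
      P.mesh K * |C.e| / ec * |A ⟨z.shift ν, μ⟩ - A ⟨z, μ⟩| ≤ creg * ec ^ (β - 1) / (P.L : ℝ) ^ K)
    (hsmall : (P.d : ℝ) ^ 2 * creg * ec ^ β ≤ 1 / 3) (msq : ℝ) (j : Lab P K K₀)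
    (w : ScalarField P 0 N) (hw : ∀ x, x ∉ piece K K₀ Ω j → w x = 0) :
    min 2 (a * (1 - ((P.L : ℝ) ^ 2)⁻¹) / 4) * ((P.mesh K)⁻¹ ^ 2) * siteInner w w + msq * siteInner w w
      ≤ siteInner w (covOpK C (piece K K₀ Ω j) A msq a K w) := by
  have hK₀' : 1 ≤ K₀ := le_trans (by norm_num) hK₀8
  have hP := piece_blockSat hK hK₀ hK₀' hN3 (blockSat_of_isBigBlockUnion (K₀ := K₀) hK hΩ) j
  have hreg' : ∀ z ∈ piece K K₀ Ω j, ∀ μ ν : Fin P.d,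
      P.mesh K * |C.e| / ec * |A ⟨z.shift ν, μ⟩ - A ⟨z, μ⟩| ≤ creg * ec ^ (β - 1) / (P.L : ℝ) ^ K :=
    fun z hz => hreg z (piece_subset Ω j hz)
  have h := coercive_covOpK_of_reg223 C ha hL hK1 hK (piece K K₀ Ω j) hP A hec hreg' hsmall msq w hw
  rwa [add_mul] at h

/-- **LEMMA 2.1 (2.15) FOR THE PIECES OF A BIG-BLOCK REGION ON THE (Higgs)₂,₃ CARRIER AT A (2.23)-REGULAR `A`**: `Ω ⊂ T_ε` a big-block
union, `A` (2.23)-regular on `Ω` with `d²·c·e_K^β ≤ 1/3`, `1 ≤ K ≤ K_P`, `K₀ ≥ 8`, `K₀ ∣ M_P`, `3M ≤ |T_ε|_μ`, `m² > 0`, `a > 0`, `L ≥ 2`; for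
`ψ` supported in `Ω ∩ □_j`: `‖G_K(Ω ∩ □_j, A)ψ‖₂ ≤ γ₀⁻¹(L^Kε)²‖ψ‖₂` and `⟨Gψ, −Δ^N_{A,Ω∩□_j}Gψ⟩ ≤ γ₀⁻¹(L^Kε)²‖ψ‖₂²`.
[cite: Balaban1983RegularityDecay, Lemma 2.1 (2.15) p.577] [cite: Balaban1982Higgs1, (2.20), (2.23) p.610] -/
theorem lemma21_piece {a msq : ℝ} (ha : 0 < a) (hL : 1 < P.L) (hmsq : 0 < msq) (hK1 : 1 ≤ K) (hK : K ≤ P.K)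
    (hK₀ : K₀ ∣ P.M) (hK₀8 : 8 ≤ K₀) (hN3 : ∀ μ, 3 * half P K K₀ ≤ P.sitesPerDir 0 μ)
    {Ω : Finset (HiggsLattice.Site P 0)} (hΩ : IsBigBlockUnion K K₀ Ω)
    (A : HiggsLattice.VecField P 0) {creg β ec : ℝ} (hec : 0 < ec)
    (hreg : ∀ z ∈ Ω, ∀ μ ν : Fin P.d,
      P.mesh K * |C.e| / ec * |A ⟨z.shift ν, μ⟩ - A ⟨z, μ⟩| ≤ creg * ec ^ (β - 1) / (P.L : ℝ) ^ K)
    (hsmall : (P.d : ℝ) ^ 2 * creg * ec ^ β ≤ 1 / 3) (j : Lab P K K₀)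
    (ψ : ScalarField P 0 N) (hψ : ∀ x, x ∉ piece K K₀ Ω j → ψ x = 0) :
    sNorm (propagatorK C (piece K K₀ Ω j) A msq a K ψ)
        ≤ (min 2 (a * (1 - ((P.L : ℝ) ^ 2)⁻¹) / 4))⁻¹ * P.mesh K ^ 2 * sNorm ψ ∧
      siteInner (propagatorK C (piece K K₀ Ω j) A msq a K ψ)
          (covLaplacianN C (piece K K₀ Ω j) A (propagatorK C (piece K K₀ Ω j) A msq a K ψ))
        ≤ (min 2 (a * (1 - ((P.L : ℝ) ^ 2)⁻¹) / 4))⁻¹ * P.mesh K ^ 2 * sNorm ψ ^ 2 := by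
  have hK₀' : 1 ≤ K₀ := le_trans (by norm_num) hK₀8
  have hL' : (1 : ℝ) < P.L := by exact_mod_cast hL
  have hak : 0 ≤ B1.aSeq a P.L K := (B1.aSeq_pos ha hL' hK1).le
  have hP := piece_blockSat hK hK₀ hK₀' hN3 (blockSat_of_isBigBlockUnion (K₀ := K₀) hK hΩ) j
  refine lemma21_of_coercive C (piece K K₀ Ω j) A hP hmsq hak (gammaReg_pos ha hL) ?_ ψ hψ
  intro w hw
  have h := coercive_piece C ha hL hK1 hK hK₀ hK₀8 hN3 hΩ A hec hreg hsmall msq j w hw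
  have h0 : 0 ≤ msq * siteInner w w := mul_nonneg hmsq.le (siteInner_self_nonneg w)
  linarith

/-- `h_jφ` is supported in the piece `Ω ∩ □_j` when `φ` is supported in `Ω` (`supp h_j ⊂ □_j`). [cite: Balaban1983RegularityDecay, §2 p.575] -/
theorem hTor_smul_supported_piece (hK : K ≤ P.K) (hK₀ : K₀ ∣ P.M) (hK₀8 : 8 ≤ K₀) (Ω : Finset (HiggsLattice.Site P 0))
    (j : Lab P K K₀) (φ : ScalarField P 0 N) (hφ : ∀ x, x ∉ Ω → φ x = 0) :
    ∀ x, x ∉ piece K K₀ Ω j → (hTor K K₀ j • φ) x = 0 := by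
  intro x hx
  rw [Pi.smul_apply']
  by_cases hxΩ : x ∈ Ω
  · have hxc : x ∉ cube K K₀ j := fun h => hx (mem_piece.2 ⟨hxΩ, h⟩)
    have h0 : hTor K K₀ j x = 0 := by
      by_contra hne
      exact hxc (mem_cube_of_near_succ hK₀8 (near_mono (Nat.le_succ _) (near_rS_of_hTor_ne_zero hK hK₀ hK₀8 hne)))
    rw [h0, zero_smul]
  · rw [hφ x hxΩ, smul_zero]

/-- `‖h_jφ‖₂ ≤ ‖φ‖₂` (`0 ≤ h_j ≤ 1`). [cite: Balaban1983RegularityDecay, §2 p.575] -/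
theorem sNorm_hTor_smul_le (hK : K ≤ P.K) (hK₀ : K₀ ∣ P.M) (hK₀' : 1 ≤ K₀) (j : Lab P K K₀) (φ : ScalarField P 0 N) :
    sNorm (hTor K K₀ j • φ) ≤ sNorm φ := by
  have h := sNorm_le_of_norm_le (f := hTor K K₀ j • φ) (g := φ) zero_le_one fun x => by
    rw [Pi.smul_apply', norm_smul, Real.norm_eq_abs, one_mul]
    exact mul_le_of_le_one_left (norm_nonneg _) (abs_hTor_le_one hK hK₀ hK₀' j x)
  rwa [one_mul] at h

/-- **THE `‖·‖_{2,2}` LETTER AT A BOUNDARY PIECE: `‖K_jG_k(□_j, A_j)h_j‖_{2,2} ≤ c₂O(1)M⁻¹` (the factor of (2.21))** for the (Higgs)₂,₃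
carrier.  `Ω ⊂ T_ε` a
big-block union, `□_j ⊄ Ω` (so `A_j = A` and `□_j ↦ Ω ∩ □_j`), `A` (2.23)-regular on `Ω` with `d²·c·e_K^β ≤ 1/3`, `1 ≤ K ≤ K_P`, `K₀ ≥ 8`,
`K₀ ∣ M_P`, `3M ≤ |T_ε|_μ`, `m² > 0`, `a > 0`, `L ≥ 2`, and `φ` supported in `Ω`: the letter `b_j = −K_jG_j h_j` of (2.11) satisfies
`‖b_jφ‖₂ ≤ s·(γ₀⁻¹ + 2(dγ₀⁻¹)^{1/2} + aγ₀⁻¹)·K₀⁻¹·‖φ‖₂`, `s = d(D₁+D₂)`, `γ₀ = min{2, a(1 − L⁻²)/4}` — Lemma 2.1 on the piece, the sizes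
`|∂h_j| ≤ s/(K₀L^K)`, `|Δ^N_{Ω∩□_j}h_j| ≤ s/(K₀²L^{2K})` (flat normal), block oscillation `≤ s/K₀` of `B1TorusRegionHSizes`, and `a_K ≤ a`.
[cite: Balaban1983RegularityDecay, (2.10)–(2.11) p.576, Lemma 2.1 (2.15) p.577, (2.21) p.578] [cite: Balaban1982Higgs1, Prop. 2.1 p.610] -/
theorem sNorm_bOp_le_of_bad {a msq : ℝ} (ha : 0 < a) (hL : 1 < P.L) (hmsq : 0 < msq) (hK1 : 1 ≤ K) (hK : K ≤ P.K)
    (hK₀ : K₀ ∣ P.M) (hK₀8 : 8 ≤ K₀) (hN3 : ∀ μ, 3 * half P K K₀ ≤ P.sitesPerDir 0 μ)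
    {Ω : Finset (HiggsLattice.Site P 0)} (hΩ : IsBigBlockUnion K K₀ Ω)
    (A : HiggsLattice.VecField P 0) {creg β ec : ℝ} (hec : 0 < ec)
    (hreg : ∀ z ∈ Ω, ∀ μ ν : Fin P.d,
      P.mesh K * |C.e| / ec * |A ⟨z.shift ν, μ⟩ - A ⟨z, μ⟩| ≤ creg * ec ^ (β - 1) / (P.L : ℝ) ^ K)
    (hsmall : (P.d : ℝ) ^ 2 * creg * ec ^ β ≤ 1 / 3) {j : Lab P K K₀} (hj : ¬ cube K K₀ j ⊆ Ω)
    (φ : ScalarField P 0 N) (hφ : ∀ x, x ∉ Ω → φ x = 0) :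
    sNorm (bOp C K K₀ Ω A msq a j φ)
      ≤ ((dd P : ℝ) + 1) * (D1 hprof + D2 hprof)
          * ((min 2 (a * (1 - ((P.L : ℝ) ^ 2)⁻¹) / 4))⁻¹
              + 2 * Real.sqrt (P.d * (min 2 (a * (1 - ((P.L : ℝ) ^ 2)⁻¹) / 4))⁻¹)
              + a * (min 2 (a * (1 - ((P.L : ℝ) ^ 2)⁻¹) / 4))⁻¹) / K₀ * sNorm φ := by
  have hK₀' : 1 ≤ K₀ := le_trans (by norm_num) hK₀8
  have hL' : (1 : ℝ) < P.L := by exact_mod_cast hL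
  have hak : 0 ≤ B1.aSeq a P.L K := (B1.aSeq_pos ha hL' hK1).le
  have haK : B1.aSeq a P.L K ≤ a := B1.aSeq_le ha hL' K hK1
  have hP := piece_blockSat hK hK₀ hK₀' hN3 (blockSat_of_isBigBlockUnion (K₀ := K₀) hK hΩ) j
  set γ₀ : ℝ := min 2 (a * (1 - ((P.L : ℝ) ^ 2)⁻¹) / 4) with hγ₀
  have hγ : 0 < γ₀ := gammaReg_pos ha hL
  have hγ' : 0 ≤ γ₀⁻¹ := inv_nonneg.2 hγ.le
  set s : ℝ := ((dd P : ℝ) + 1) * (D1 hprof + D2 hprof) with hs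
  have hD1 := D1_nonneg contDiff_hprof hasCompactSupport_hprof
  have hD2 := D2_nonneg contDiff_hprof hasCompactSupport_hprof
  have hs0 : 0 ≤ s := by positivity
  have hn : ((((P.L - 1 + 1) ^ K : ℕ) : ℝ)) = (P.L : ℝ) ^ K := by rw [predL_succ, Nat.cast_pow]
  have hLK : (0 : ℝ) < (P.L : ℝ) ^ K := pow_pos (by linarith) K
  have hK₀r : (0 : ℝ) < K₀ := by exact_mod_cast hK₀'
  -- the field of `b_j`, its support and norm
  set ψ := hTor K K₀ j • φ with hψdef
  have hψ : ∀ x, x ∉ piece K K₀ Ω j → ψ x = 0 := hTor_smul_supported_piece hK hK₀ hK₀8 Ω j φ hφ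
  have hψφ : sNorm ψ ≤ sNorm φ := sNorm_hTor_smul_le hK hK₀ hK₀' j φ
  -- coercivity on the piece
  have hlow : ∀ w : ScalarField P 0 N, (∀ x, x ∉ piece K K₀ Ω j → w x = 0) →
      γ₀ * ((P.mesh K)⁻¹ ^ 2) * siteInner w w ≤ siteInner w (covOpK C (piece K K₀ Ω j) A msq a K w) := by
    intro w hw
    have h := coercive_piece C ha hL hK1 hK hK₀ hK₀8 hN3 hΩ A hec hreg hsmall msq j w hw
    have h0 : 0 ≤ msq * siteInner w w := mul_nonneg hmsq.le (siteInner_self_nonneg w)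
    linarith
  -- the three sizes of `h_j`
  have h1 : ∀ x μ, |hTor K K₀ j x - hTor K K₀ j (x.shift μ)| ≤ s / K₀ / (P.L : ℝ) ^ K := fun x μ => by
    rw [abs_sub_comm, ← hn]; exact abs_hTor_shift_sub_le hK hK₀ hK₀8 hN3 j x μ
  have h2 : ∀ x : HiggsLattice.Site P 0, |∑ μ : Fin P.d,
      ((if x ∈ piece K K₀ Ω j ∧ x.shift μ ∈ piece K K₀ Ω j then hTor K K₀ j x - hTor K K₀ j (x.shift μ) else 0)
        + (if x ∈ piece K K₀ Ω j ∧ x.unshift μ ∈ piece K K₀ Ω j then hTor K K₀ j x - hTor K K₀ j (x.unshift μ) else 0))|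
      ≤ s / (K₀ : ℝ) ^ 2 / ((P.L : ℝ) ^ K) ^ 2 := by
    intro x
    change |nlapH (piece K K₀ Ω j) (hTor K K₀ j) x| ≤ _
    by_cases hx : x ∈ piece K K₀ Ω j
    · rw [← hn]; exact abs_nlapH_piece_le hK hK₀ hK₀8 hN3 hΩ j hx
    · rw [nlapH_eq_zero_of_not_mem _ hx, abs_zero]; positivity
  have h3 : ∀ x x' : HiggsLattice.Site P 0, blockIter K x = blockIter K x' → |hTor K K₀ j x - hTor K K₀ j x'| ≤ s / K₀ :=
    fun x x' hb => abs_hTor_sub_le_of_blockIter_eq hK hK₀ hK₀8 hN3 j hb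
  -- the letter
  have hmain := sNorm_comm_propagatorK_le C (piece K K₀ Ω j) A hK hP hmsq hak hγ hlow
    (by positivity) (by positivity) (by positivity) h1 h2 h3 ψ hψ
  -- `b_jφ = −[H_j, h_j]G_j(h_jφ)`
  have hb : bOp C K K₀ Ω A msq a j φ
      = -(covOpK C (piece K K₀ Ω j) A msq a K (hTor K K₀ j • propagatorK C (piece K K₀ Ω j) A msq a K ψ)
          - hTor K K₀ j • covOpK C (piece K K₀ Ω j) A msq a K (propagatorK C (piece K K₀ Ω j) A msq a K ψ)) := by
    rw [bOp_apply]
    unfold Hloc Gloc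
    rw [fld_of_bad hj]
  rw [hb, sNorm_neg']
  refine hmain.trans ?_
  -- arithmetic: `σ₂γ₀⁻¹L^{2K} + 2σ₁(dγ₀⁻¹)^{1/2}L^K + a_Kσ₃γ₀⁻¹ ≤ s(γ₀⁻¹ + 2(dγ₀⁻¹)^{1/2} + aγ₀⁻¹)/K₀`
  have hcoef : s / (K₀ : ℝ) ^ 2 / ((P.L : ℝ) ^ K) ^ 2 * γ₀⁻¹ * ((P.L : ℝ) ^ K) ^ 2
        + 2 * (s / K₀ / (P.L : ℝ) ^ K) * Real.sqrt (P.d * γ₀⁻¹) * (P.L : ℝ) ^ K + B1.aSeq a P.L K * (s / K₀) * γ₀⁻¹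
      = (s * γ₀⁻¹ / K₀ + 2 * s * Real.sqrt (P.d * γ₀⁻¹) + B1.aSeq a P.L K * s * γ₀⁻¹) / K₀ := by
    field_simp
  have hle : (s * γ₀⁻¹ / K₀ + 2 * s * Real.sqrt (P.d * γ₀⁻¹) + B1.aSeq a P.L K * s * γ₀⁻¹) / K₀
      ≤ s * (γ₀⁻¹ + 2 * Real.sqrt (P.d * γ₀⁻¹) + a * γ₀⁻¹) / K₀ := by
    refine div_le_div_of_nonneg_right ?_ hK₀r.le
    have e1 : s * γ₀⁻¹ / K₀ ≤ s * γ₀⁻¹ := div_le_self (mul_nonneg hs0 hγ') (by exact_mod_cast hK₀')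
    have e2 : B1.aSeq a P.L K * s * γ₀⁻¹ ≤ a * s * γ₀⁻¹ :=
      mul_le_mul_of_nonneg_right (mul_le_mul_of_nonneg_right haK hs0) hγ'
    nlinarith
  rw [hcoef]
  exact (mul_le_mul_of_nonneg_right hle (sNorm_nonneg ψ)).trans
    (mul_le_mul_of_nonneg_left hψφ (by positivity))

end BoundaryPieces

end Literature.MathematicalPhysics.QuantumFieldTheory.Balaban1983to89.B1Lemma21RegularRegion

end
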